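import Summits.HodgeConjecture.HodgeConjecture.Theorems.LimitExtensionMiddleDivisorSupportSuffices
import Summits.HodgeConjecture.HodgeConjecture.Theorems.LimitExtensionDivisorInduction
import Literature.AlgebraicGeometry.HodgeTheory.PencilStepBelowMiddleHolds

/-!
# Route LimitExtension — `MiddleDivisorSupportSuffices` (item stmt-HodgeConjecture-10865) holds

The glue item `MiddleDivisorSupportSuffices` of route `LimitExtension`:

  (Hodge models) → MiddleDivisorSupport → HodgeConjecture,

i.e. if every rational middle-degree class of Hodge type `(p, p)` on a smooth projective complex
`2p`-fold (`p ≥ 1`) is supported on a divisor (lies in `supportedClasses X (2 * p) 1`), then the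
Hodge conjecture holds.  This is the planner's CLOSING RECIPE of the hold of 2026-08-16 executed now
that both inputs are theorems of the tree: the assembly
`middleDivisorSupportSuffices_of_nodalSupport` (strong induction on the dimension, inner induction
on the codimension; file `LimitExtensionMiddleDivisorSupportSuffices`) fed with

* `DivisorInduction` (shared item stmt-HodgeConjecture-1082) — proved unconditionally as
  `limitExtension_divisorInduction_proof` (Deligne *Hodge III* 8.2.7/8.2.8 for snc boundaries, Gysin
  lift of Hodge classes, push-forward), and
* `PencilReduction` (shared item stmt-HodgeConjecture-1083) — the pencil step below the middle,
  proved unconditionally as `mem_algebraicClasses_of_two_mul_le` (Thomas 2005 Prop. 2 /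
  de Cataldo–Migliorini 2009 Prop. 4.5; its codimension-`p - 1` hypothesis is not even used).

No definitions, no named-fact hypotheses, no sorry.  (With Hodge models discharged —
`nonempty_hodgeModel_holds` — `MiddleDivisorSupport` alone implies the Hodge conjecture; that
corollary is already in the tree as `hodgeConjecture_of_middleDivisorSupport`, route
`LinearSystemTorelli`, whose `MiddleDivisorSupport` has the same body.)
-/

-- `Summit.HodgeConjecture.HodgeConjecture.Theorems` is the mandated namespace (single-problem
-- summit: Problem = Summit), which `linter.dupNamespace` flags on every declaration; the lakefile
-- turns the linter off tree-wide (weak option), restated here so stand-alone elaboration is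
-- warning-free too.
set_option linter.dupNamespace false

noncomputable section

namespace Summit.HodgeConjecture.HodgeConjecture.Theorems

open Literature.AlgebraicGeometry.Motives Literature.AlgebraicGeometry.HodgeTheory
  Literature.AlgebraicTopology.SingularHomology

/-- **Item stmt-HodgeConjecture-10865 (`MiddleDivisorSupportSuffices`), route `LimitExtension`**:
Hodge models and `MiddleDivisorSupport` (every rational middle-degree `(p, p)` class on a smooth
projective complex `2p`-fold, `p ≥ 1`, has coniveau `≥ 1`) imply the Hodge conjecture — by
`middleDivisorSupportSuffices_of_nodalSupport` (strong induction on the dimension: codimension `0`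
trivially, below the middle by the pencil step, the middle by `MiddleDivisorSupport` and divisor
induction, above the middle by Andreotti–Frankel and divisor induction) with its two hypotheses
discharged by the tree's theorems `limitExtension_divisorInduction_proof` (item
stmt-HodgeConjecture-1082, the verbatim body after unfolding the route decl) and
`mem_algebraicClasses_of_two_mul_le` (item stmt-HodgeConjecture-1083).  The type is literally the
route decl `Summit.HodgeConjecture.HodgeConjecture.Theses.LimitExtension.MiddleDivisorSupportSuffices`.
[cite: Thomas2005Nodes, §2 Prop. 2] [cite: DecataldoMigliorini2009, §4 Prop. 4.5]
[cite: DeligneHodgeIII1974, Prop. 8.2.7 and Cor. 8.2.8] -/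
theorem limitExtension_middleDivisorSupportSuffices_proof :
    Summit.HodgeConjecture.HodgeConjecture.Theses.LimitExtension.MiddleDivisorSupportSuffices := by
  refine middleDivisorSupportSuffices_of_nodalSupport ?_ ?_
  · -- `DivisorInduction` (stmt-1082): the route decl unfolds to the verbatim body
    have h := limitExtension_divisorInduction_proof
    unfold Summit.HodgeConjecture.HodgeConjecture.Theses.LimitExtension.DivisorInduction at h
    exact h
  · -- `PencilReduction` (stmt-1083): the unconditional pencil step below the middle
    intro m p _ hpm hHC _ X hX c hc hpp
    exact mem_algebraicClasses_of_two_mul_le hX hHC p c hpm hc hpp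

end Summit.HodgeConjecture.HodgeConjecture.Theorems

end
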